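import Summits.QuantumFields.BalabanUV.Beta.GAN24.BlockFluxTower

/-!
# `BalabanUV.Beta.GAN24.FluxTowerCoClosed` — binder row G-an2-4 ∕ (CONV-C), CT-W (route «WC-TL» ∕ (Q-R) «QR-LL», RULING R-gan24p1-g29-2's re-cut (Q-R)^{cc} + (DIV)):
# **CO-CLOSEDNESS AND FLUX-FREENESS PROPAGATE ALONG THE WHOLE FLUX TOWER — EXACTLY** (a co-closed letter stays co-closed under every S-slot push; a letter whose
# `N`-block fluxes all vanish is co-closed after ONE push and hence invisible to the flux tower from the next level on; a letter off the boundary layers of the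
# `N^k`-refinement of `T` contributes ZERO flux through `T` after `k` pushes — the tower forms of the OWNER gan24-p1 g29's one-level comb lemmas
# `TableSlotCoDress.divV_e3OfK_comb_eq_zero_of_fluxFree ∕ _of_divFree` (p332309 ✓) and of PART 1's `regionSum_divV_e3OfK_eq_zero_of_offLayers`, for ANY sequence of
# decaying kernels and for the END's `unitStepMap` transport BY NAME; sequel of `GAN24/BlockFluxTower`; G-an2-4 formalisation swarm → CRUX TEAM (2), leaf prover
# `b2b-balaban-gan24-formalise-leaf-03`, gen 62, programme «FLUX-REC» PART 4; module name PROVISIONAL — the row owner gan24-p1 may rename ∕ re-home it)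

NOT IN PRINT; OUR BOOKKEEPING.  HONEST FRAMING (cell contract, verbatim): «discharging `BetaPertH` makes Bałaban's UV stability
UNCONDITIONAL — a real constructive-QFT result; it is NOT the continuum limit and NOT the Clay problem.»  HONEST DEPENDENCY (verbatim):
«continuum YM on T⁴ ⇐ BetaPertH ∧ nine spine estimates (0/9 proved); BetaPertH ⇐ (D1) ∧ (D4) ∧ CAP+tail; G-an2-4 gates asym, D1 and
NE2/3/4.»

WHAT ([folklore] kernel algebra BY NAME over my g58 `E3SlotDivergence.divV_e3OfK ∕ divV_smul_family`, PART 1 `BlockFluxRegion` (`finsetSum_divV_eq_zero_of_offLayers`), PART 2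
`BlockFluxTower` (`exists_bdd_transport`, `regionSum_divV_transport`, `unitStepMap_eq_smul_e3OfK`), leaf-01's `AffineUnroll.transport`, p2's `WardResidualSUnroll.bdd_e3OfK`; for ANY
decaying kernels `K_j` (rates `δ_j > 0`), `N ≥ 1`, scalars `c_j`, bounded `S`, UNDER (hH)_j — DISCHARGED for the END's unit comb kernels in §4; generic `d`; 0 `def`, 0 cite,
0 `def … : Prop`, 0 sorry):
* §1 one level, general kernel: `divV_e3OfK_eq_zero_of_fluxFree` (all `N`-block fluxes of `S` vanish ⇒ `divV (e3OfK N K S) ≡ 0`), `divV_e3OfK_eq_zero_of_divFree`, `sandwich_zero`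
  (the kernel-only flux map kills `0`), `transport_sandwich_zero`.
* §2 THE TOWER: **`divV_transport_eq_zero_of_divFree`** — `divV S ≡ 0 ⇒ divV (transport (j S ↦ c_j • e3OfK N K_j S) m k S) ≡ 0` for every `k` (co-closedness propagates);
  **`divV_transport_succ_eq_zero_of_fluxFree`** — all `N`-block fluxes of `S` vanish ⇒ `divV (transport … m (k+1) S) ≡ 0` for every `k` (flux-free ⇒ co-closed after ONE
  push, then §2); `regionSum_divV_transport_eq_zero_of_divFree ∕ _succ_eq_zero_of_fluxFree` (hence ZERO flux through every region at every later level);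
  **`regionSum_divV_transport_eq_zero_of_offLayers`** — a letter vanishing on the boundary layers of `U_{N^k}(T)` has ZERO flux through `T` after `k` pushes (PART 2's
  identity ⨾ PART 1's layer lemma ⨾ `transport_sandwich_zero`).
* §3 `…_of_exists` forms (decay constants `∃` per level).
* §4 THE END's TRANSPORT BY NAME (`SrecBornSector.unitStepMap Lc (toSite rr) cE`, in-block root): `divV_transport_unitStepMap_eq_zero_of_divFree`,
  `divV_transport_unitStepMap_succ_eq_zero_of_fluxFree`, `regionSum_divV_transport_unitStepMap_eq_zero_of_offLayers`.

USE: the (Q-R)^{cc} END of RULING R-gan24p1-g29-2 (4) transports CO-CLOSED letters; these lemmas certify that the class is stable under the literal's transport at every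
depth (so the flux tower (DIV) receives NOTHING from it), and that INTERIOR born letters (flux-free through their `Lc`-blocks) join the class after one push.  Asserts NO
size of anything; decides nothing about (DIV) ∕ (DL) ∕ K-LL-4′; discharges NOTHING of (Q-R) ∕ (LT) ∕ (LAY) ∕ (S) ∕ «T2Shape» ∕ «T2Drift» ∕ (hW, hWall); 0 wall binders; NEVER
«G-an2-4 closed» as (CONV-C); NOT D1, NOT `BetaPertH`, NOT continuum, NOT Clay; not in print — our bookkeeping.  Unit `b2b-balaban-gan24-formalise-leaf-03` (gen 62), 2026-08-22.
-/

noncomputable section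

open Finset
open scoped BigOperators
open Literature.MathematicalPhysics.QuantumFieldTheory
open Literature.MathematicalPhysics.QuantumFieldTheory.Balaban1983to89
open Literature.MathematicalPhysics.QuantumFieldTheory.Balaban1983to89.Beta
open B6BondElimination (unitVec)
open ExpKernelCalculus (MKer Site Decays comp)
open OneStepResolventKernel (Fib)
open OneStepKernelFamily (colH KInvStep)
open BalabanStepJetsSucc (mmRead)
open KernelWard (divV Bdd)
open AffineAveraging (box toSite)
open Summit.QuantumFields.BalabanUV.Beta.KernelWardRelative (gaugeWt comp_zero_left)
open Literature.MathematicalPhysics.QuantumFieldTheory.Balaban1983to89.Beta.StepDriftWitness (comp_zero_right)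
open Summit.QuantumFields.BalabanUV.Beta.SpineRooted (e3OfK)
open Summit.QuantumFields.BalabanUV.Beta.GAN24.AffineUnroll (transport transport_zero transport_succ transport_succ' transport_one)
open Summit.QuantumFields.BalabanUV.Beta.GAN24.WardResidualSUnroll (bdd_e3OfK)
open Summit.QuantumFields.BalabanUV.Beta.GAN24.E3SlotDivergence (divV_e3OfK divV_smul_family)
open Summit.QuantumFields.BalabanUV.Beta.GAN24.BlockFluxRegion (finsetSum_divV_eq_zero_of_offLayers)
open Summit.QuantumFields.BalabanUV.Beta.GAN24.BlockFluxTower (exists_bdd_transport regionSum_divV_transport unitStepMap_eq_smul_e3OfK)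
open Summit.QuantumFields.BalabanUV.Beta.GAN24.Lin4SlotDivergence (hH_unitK_comb)
open Summit.QuantumFields.BalabanUV.Beta.GAN24.SrecBornSector (unitStepMap)
open Summit.QuantumFields.BalabanUV.Beta.HessKerDressedUnits (unitK decays_unitK)
open Summit.QuantumFields.BalabanUV.Beta.GAN24.CombesThomas (sfStep smStep)
open Summit.QuantumFields.BalabanUV.Beta.AxialDressingRooted (coDressKBmAt one_le_of_neZero decays_coDressKBmAt_KInvStep)

namespace Summit.QuantumFields.BalabanUV.Beta.GAN24.FluxTowerCoClosed

variable {d N : ℕ}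

/-! ## §1 One level, general kernel -/

section OneStep

variable {K : MKer (d + 1) (Fib d)} {C δ : ℝ} {S : Fin (d + 1) → (Fin (d + 1) → ℤ) → MKer (d + 1) (Fib d)} {B : ℝ} {cH : ℝ}

/-- [folklore] The kernel-only flux map kills the zero kernel: `−(c • mmRead N (K ∘ 0 ∘ K)) = 0`. -/
theorem sandwich_zero (K : MKer (d + 1) (Fib d)) (N : ℕ) (c : ℝ) :
    -(c • mmRead N (comp (comp K (0 : MKer (d + 1) (Fib d))) K)) = 0 := by
  have h0 : mmRead N (0 : MKer (d + 1) (Fib d)) = 0 := by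
    funext x z a b
    cases a <;> cases b <;> simp [mmRead]
  rw [comp_zero_right, comp_zero_left, h0, smul_zero, neg_zero]

/-- [folklore] … hence so does every transport of such maps: `transport (j V ↦ −((c_j·c_{H,j}) • mmRead N (K_j ∘ V ∘ K_j))) m k 0 = 0`. -/
theorem transport_sandwich_zero (K : ℕ → MKer (d + 1) (Fib d)) (N : ℕ) (c cH : ℕ → ℝ) (m : ℕ) :
    ∀ k, transport (fun j V => -((c j * cH j) • mmRead N (comp (comp (K j) V) (K j)))) m k (0 : MKer (d + 1) (Fib d)) = 0
  | 0 => transport_zero _ _ _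
  | k + 1 => by rw [transport_succ, transport_sandwich_zero K N c cH m k]; exact sandwich_zero _ _ _

/-- [folklore] **A FLUX-FREE LETTER PUSHES TO A CO-CLOSED LETTER** (general decaying kernel, (hH); the comb case is the OWNER's
`TableSlotCoDress.divV_e3OfK_comb_eq_zero_of_fluxFree`): if every `N`-block flux `Σ_{v ∈ box N} divV S (N•y + toSite v)` of a bounded letter vanishes, then
`divV (e3OfK N K S) y = 0` at every coarse `y`. -/
theorem divV_e3OfK_eq_zero_of_fluxFree (hK : Decays K C δ) (hδ : 0 < δ) (hN : 1 ≤ N) (hS : ∀ κ u x z a b, |S κ u x z a b| ≤ B)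
    (hH : ∀ (y : Fin (d + 1) → ℤ) (κ' : Fin (d + 1)) (u : Fin (d + 1) → ℤ),
      ∑ μ, (colH K N μ (y - unitVec μ) κ' u - colH K N μ y κ' u) = cH * gaugeWt N y κ' u)
    (hflux : ∀ y : Fin (d + 1) → ℤ, ∑ v ∈ box (d + 1) N, divV S ((N : ℤ) • y + toSite v) = 0) (y : Fin (d + 1) → ℤ) :
    divV (e3OfK N K S) y = 0 := by
  rw [divV_e3OfK hK hδ hN hS hH y, hflux y]
  exact sandwich_zero K N cH

/-- [folklore] **A CO-CLOSED LETTER PUSHES TO A CO-CLOSED LETTER** (`divV S ≡ 0 ⇒ divV (e3OfK N K S) ≡ 0`; the comb case is the OWNER's `…_of_divFree`). -/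
theorem divV_e3OfK_eq_zero_of_divFree (hK : Decays K C δ) (hδ : 0 < δ) (hN : 1 ≤ N) (hS : ∀ κ u x z a b, |S κ u x z a b| ≤ B)
    (hH : ∀ (y : Fin (d + 1) → ℤ) (κ' : Fin (d + 1)) (u : Fin (d + 1) → ℤ),
      ∑ μ, (colH K N μ (y - unitVec μ) κ' u - colH K N μ y κ' u) = cH * gaugeWt N y κ' u)
    (hdiv : ∀ y : Fin (d + 1) → ℤ, divV S y = 0) (y : Fin (d + 1) → ℤ) :
    divV (e3OfK N K S) y = 0 :=
  divV_e3OfK_eq_zero_of_fluxFree hK hδ hN hS hH (fun _ => Finset.sum_eq_zero fun _ _ => hdiv _) y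

end OneStep

/-! ## §2 The tower: co-closedness and flux-freeness propagate to every depth -/

section Tower

variable {K : ℕ → MKer (d + 1) (Fib d)} {C δ : ℕ → ℝ} {c cH : ℕ → ℝ}
  {S : Fin (d + 1) → (Fin (d + 1) → ℤ) → MKer (d + 1) (Fib d)} {B : ℝ}

/-- [folklore] **CO-CLOSEDNESS PROPAGATES ALONG THE WHOLE TOWER**: for decaying `K_j`, `N ≥ 1`, scalars `c_j`, a bounded CO-CLOSED bottom letter (`divV S ≡ 0`) and
(hH)_j, every transported letter is co-closed: `divV (transport (j S ↦ c_j • e3OfK N K_j S) m k S) y = 0` for all `k, y` — the class of the (Q-R)^{cc} END is stable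
under the literal's level maps at every depth. -/
theorem divV_transport_eq_zero_of_divFree (hK : ∀ j, Decays (K j) (C j) (δ j)) (hδ : ∀ j, 0 < δ j) (hN : 1 ≤ N)
    (hS : ∀ κ u x z a b, |S κ u x z a b| ≤ B)
    (hH : ∀ (j : ℕ) (y : Fin (d + 1) → ℤ) (κ' : Fin (d + 1)) (u : Fin (d + 1) → ℤ),
      ∑ μ, (colH (K j) N μ (y - unitVec μ) κ' u - colH (K j) N μ y κ' u) = cH j * gaugeWt N y κ' u)
    (hdiv : ∀ y : Fin (d + 1) → ℤ, divV S y = 0) (m : ℕ) :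
    ∀ (k : ℕ) (y : Fin (d + 1) → ℤ), divV (transport (fun j S => c j • e3OfK N (K j) S) m k S) y = 0
  | 0, y => by rw [transport_zero]; exact hdiv y
  | k + 1, y => by
    obtain ⟨B', hB'⟩ := exists_bdd_transport hK hδ c N hS m k
    simp only [transport_succ]
    rw [divV_smul_family, divV_e3OfK_eq_zero_of_divFree (hK (m + k)) (hδ (m + k)) hN hB' (hH (m + k))
      (divV_transport_eq_zero_of_divFree hK hδ hN hS hH hdiv m k) y, smul_zero]

/-- [folklore] **A FLUX-FREE LETTER IS INVISIBLE TO THE TOWER FROM THE NEXT LEVEL ON**: if every `N`-block flux of the bounded bottom letter vanishes, then after ONE push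
the letter is co-closed (§1) and stays so: `divV (transport … m (k+1) S) y = 0` for all `k, y` (right peel `transport_succ'`, then `divV_transport_eq_zero_of_divFree`
from level `m+1` with the bounded letter `c_m • e3OfK N K_m S`). -/
theorem divV_transport_succ_eq_zero_of_fluxFree (hK : ∀ j, Decays (K j) (C j) (δ j)) (hδ : ∀ j, 0 < δ j) (hN : 1 ≤ N)
    (hS : ∀ κ u x z a b, |S κ u x z a b| ≤ B)
    (hH : ∀ (j : ℕ) (y : Fin (d + 1) → ℤ) (κ' : Fin (d + 1)) (u : Fin (d + 1) → ℤ),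
      ∑ μ, (colH (K j) N μ (y - unitVec μ) κ' u - colH (K j) N μ y κ' u) = cH j * gaugeWt N y κ' u)
    (hflux : ∀ y : Fin (d + 1) → ℤ, ∑ v ∈ box (d + 1) N, divV S ((N : ℤ) • y + toSite v) = 0) (m k : ℕ) (y : Fin (d + 1) → ℤ) :
    divV (transport (fun j S => c j • e3OfK N (K j) S) m (k + 1) S) y = 0 := by
  obtain ⟨B1, hB1⟩ := exists_bdd_transport hK hδ c N hS m 1
  have hS1 : ∀ κ u x z a b, |(c m • e3OfK N (K m) S) κ u x z a b| ≤ B1 := fun κ u x z a b => by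
    simpa only [transport_one] using hB1 κ u x z a b
  have hdiv1 : ∀ y : Fin (d + 1) → ℤ, divV (c m • e3OfK N (K m) S) y = 0 := fun y => by
    rw [divV_smul_family, divV_e3OfK_eq_zero_of_fluxFree (hK m) (hδ m) hN hS (hH m) hflux y, smul_zero]
  rw [transport_succ']
  exact divV_transport_eq_zero_of_divFree hK hδ hN hS1 hH hdiv1 (m + 1) k y

/-- [folklore] Hence a co-closed bottom letter contributes ZERO flux through every region at every depth. -/
theorem regionSum_divV_transport_eq_zero_of_divFree (hK : ∀ j, Decays (K j) (C j) (δ j)) (hδ : ∀ j, 0 < δ j) (hN : 1 ≤ N)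
    (hS : ∀ κ u x z a b, |S κ u x z a b| ≤ B)
    (hH : ∀ (j : ℕ) (y : Fin (d + 1) → ℤ) (κ' : Fin (d + 1)) (u : Fin (d + 1) → ℤ),
      ∑ μ, (colH (K j) N μ (y - unitVec μ) κ' u - colH (K j) N μ y κ' u) = cH j * gaugeWt N y κ' u)
    (hdiv : ∀ y : Fin (d + 1) → ℤ, divV S y = 0) (m k : ℕ) (T : Finset (Site (d + 1))) :
    ∑ Y ∈ T, divV (transport (fun j S => c j • e3OfK N (K j) S) m k S) Y = 0 :=
  Finset.sum_eq_zero fun Y _ => divV_transport_eq_zero_of_divFree hK hδ hN hS hH hdiv m k Y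

/-- [folklore] … and a flux-free bottom letter contributes ZERO flux through every region from the next level on. -/
theorem regionSum_divV_transport_succ_eq_zero_of_fluxFree (hK : ∀ j, Decays (K j) (C j) (δ j)) (hδ : ∀ j, 0 < δ j) (hN : 1 ≤ N)
    (hS : ∀ κ u x z a b, |S κ u x z a b| ≤ B)
    (hH : ∀ (j : ℕ) (y : Fin (d + 1) → ℤ) (κ' : Fin (d + 1)) (u : Fin (d + 1) → ℤ),
      ∑ μ, (colH (K j) N μ (y - unitVec μ) κ' u - colH (K j) N μ y κ' u) = cH j * gaugeWt N y κ' u)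
    (hflux : ∀ y : Fin (d + 1) → ℤ, ∑ v ∈ box (d + 1) N, divV S ((N : ℤ) • y + toSite v) = 0) (m k : ℕ) (T : Finset (Site (d + 1))) :
    ∑ Y ∈ T, divV (transport (fun j S => c j • e3OfK N (K j) S) m (k + 1) S) Y = 0 :=
  Finset.sum_eq_zero fun Y _ => divV_transport_succ_eq_zero_of_fluxFree hK hδ hN hS hH hflux m k Y

/-- [folklore] **PERSISTENCE ALONG THE TOWER**: a bounded bottom letter vanishing on the boundary layers of the `N^k`-refinement `U_{N^k}(T)` of a finite label set `T`
contributes ZERO flux through `T` after `k` pushes — whatever it does elsewhere (PART 2's identity `regionSum_divV_transport` ⨾ PART 1's `finsetSum_divV_eq_zero_of_offLayers`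
⨾ `transport_sandwich_zero`). -/
theorem regionSum_divV_transport_eq_zero_of_offLayers (hK : ∀ j, Decays (K j) (C j) (δ j)) (hδ : ∀ j, 0 < δ j) (hN : 1 ≤ N)
    (hS : ∀ κ u x z a b, |S κ u x z a b| ≤ B)
    (hH : ∀ (j : ℕ) (y : Fin (d + 1) → ℤ) (κ' : Fin (d + 1)) (u : Fin (d + 1) → ℤ),
      ∑ μ, (colH (K j) N μ (y - unitVec μ) κ' u - colH (K j) N μ y κ' u) = cH j * gaugeWt N y κ' u)
    (m k : ℕ) (T : Finset (Site (d + 1)))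
    (hin : ∀ μ, ∀ w ∈ (T.biUnion (fun Y => (box (d + 1) (N ^ k)).image (fun v => ((N ^ k : ℕ) : ℤ) • Y + toSite v))).image (fun u => u - unitVec μ)
        \ T.biUnion (fun Y => (box (d + 1) (N ^ k)).image (fun v => ((N ^ k : ℕ) : ℤ) • Y + toSite v)), S μ w = 0)
    (hout : ∀ μ, ∀ u ∈ T.biUnion (fun Y => (box (d + 1) (N ^ k)).image (fun v => ((N ^ k : ℕ) : ℤ) • Y + toSite v))
        \ (T.biUnion (fun Y => (box (d + 1) (N ^ k)).image (fun v => ((N ^ k : ℕ) : ℤ) • Y + toSite v))).image (fun u => u - unitVec μ), S μ u = 0) :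
    ∑ Y ∈ T, divV (transport (fun j S => c j • e3OfK N (K j) S) m k S) Y = 0 := by
  rw [regionSum_divV_transport hK hδ hN hS hH m k T, finsetSum_divV_eq_zero_of_offLayers _ S hin hout]
  exact transport_sandwich_zero K N c cH m k

end Tower

/-! ## §3 Decay constants existential per level -/

section Exists

variable {K : ℕ → MKer (d + 1) (Fib d)} {c cH : ℕ → ℝ} {S : Fin (d + 1) → (Fin (d + 1) → ℤ) → MKer (d + 1) (Fib d)} {B : ℝ}

/-- [folklore] `divV_transport_eq_zero_of_divFree` with `∃ δ C` per level. -/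
theorem divV_transport_eq_zero_of_divFree_of_exists (hK : ∀ j, ∃ δ C : ℝ, 0 < δ ∧ Decays (K j) C δ) (hN : 1 ≤ N)
    (hS : ∀ κ u x z a b, |S κ u x z a b| ≤ B)
    (hH : ∀ (j : ℕ) (y : Fin (d + 1) → ℤ) (κ' : Fin (d + 1)) (u : Fin (d + 1) → ℤ),
      ∑ μ, (colH (K j) N μ (y - unitVec μ) κ' u - colH (K j) N μ y κ' u) = cH j * gaugeWt N y κ' u)
    (hdiv : ∀ y : Fin (d + 1) → ℤ, divV S y = 0) (m k : ℕ) (y : Fin (d + 1) → ℤ) :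
    divV (transport (fun j S => c j • e3OfK N (K j) S) m k S) y = 0 := by
  choose δ' C' hδ' hK' using hK
  exact divV_transport_eq_zero_of_divFree hK' hδ' hN hS hH hdiv m k y

/-- [folklore] `divV_transport_succ_eq_zero_of_fluxFree` with `∃ δ C` per level. -/
theorem divV_transport_succ_eq_zero_of_fluxFree_of_exists (hK : ∀ j, ∃ δ C : ℝ, 0 < δ ∧ Decays (K j) C δ) (hN : 1 ≤ N)
    (hS : ∀ κ u x z a b, |S κ u x z a b| ≤ B)
    (hH : ∀ (j : ℕ) (y : Fin (d + 1) → ℤ) (κ' : Fin (d + 1)) (u : Fin (d + 1) → ℤ),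
      ∑ μ, (colH (K j) N μ (y - unitVec μ) κ' u - colH (K j) N μ y κ' u) = cH j * gaugeWt N y κ' u)
    (hflux : ∀ y : Fin (d + 1) → ℤ, ∑ v ∈ box (d + 1) N, divV S ((N : ℤ) • y + toSite v) = 0) (m k : ℕ) (y : Fin (d + 1) → ℤ) :
    divV (transport (fun j S => c j • e3OfK N (K j) S) m (k + 1) S) y = 0 := by
  choose δ' C' hδ' hK' using hK
  exact divV_transport_succ_eq_zero_of_fluxFree hK' hδ' hN hS hH hflux m k y

/-- [folklore] `regionSum_divV_transport_eq_zero_of_offLayers` with `∃ δ C` per level. -/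
theorem regionSum_divV_transport_eq_zero_of_offLayers_of_exists (hK : ∀ j, ∃ δ C : ℝ, 0 < δ ∧ Decays (K j) C δ) (hN : 1 ≤ N)
    (hS : ∀ κ u x z a b, |S κ u x z a b| ≤ B)
    (hH : ∀ (j : ℕ) (y : Fin (d + 1) → ℤ) (κ' : Fin (d + 1)) (u : Fin (d + 1) → ℤ),
      ∑ μ, (colH (K j) N μ (y - unitVec μ) κ' u - colH (K j) N μ y κ' u) = cH j * gaugeWt N y κ' u)
    (m k : ℕ) (T : Finset (Site (d + 1)))
    (hin : ∀ μ, ∀ w ∈ (T.biUnion (fun Y => (box (d + 1) (N ^ k)).image (fun v => ((N ^ k : ℕ) : ℤ) • Y + toSite v))).image (fun u => u - unitVec μ)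
        \ T.biUnion (fun Y => (box (d + 1) (N ^ k)).image (fun v => ((N ^ k : ℕ) : ℤ) • Y + toSite v)), S μ w = 0)
    (hout : ∀ μ, ∀ u ∈ T.biUnion (fun Y => (box (d + 1) (N ^ k)).image (fun v => ((N ^ k : ℕ) : ℤ) • Y + toSite v))
        \ (T.biUnion (fun Y => (box (d + 1) (N ^ k)).image (fun v => ((N ^ k : ℕ) : ℤ) • Y + toSite v))).image (fun u => u - unitVec μ), S μ u = 0) :
    ∑ Y ∈ T, divV (transport (fun j S => c j • e3OfK N (K j) S) m k S) Y = 0 := by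
  choose δ' C' hδ' hK' using hK
  exact regionSum_divV_transport_eq_zero_of_offLayers hK' hδ' hN hS hH m k T hin hout

end Exists

/-! ## §4 The END's transport in units, by name -/

section Literal

variable {Lc : ℕ} [NeZero Lc] {rr : Fin (d + 1) → ℕ} {S : Fin (d + 1) → (Fin (d + 1) → ℤ) → MKer (d + 1) (Fib d)} {B : ℝ}

/-- [folklore] **THE LITERAL's TRANSPORT IN UNITS PRESERVES CO-CLOSEDNESS AT EVERY DEPTH** (`transport (unitStepMap Lc (toSite rr) cE) m k`, in-block root, bounded co-closed `S`,
any `cE`). -/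
theorem divV_transport_unitStepMap_eq_zero_of_divFree (hrr : rr ∈ box (d + 1) Lc) (cE : ℝ) (hS : ∀ κ u x z a b, |S κ u x z a b| ≤ B)
    (hdiv : ∀ y : Fin (d + 1) → ℤ, divV S y = 0) (m k : ℕ) (y : Fin (d + 1) → ℤ) :
    divV (transport (unitStepMap Lc (toSite rr) cE) m k S) y = 0 := by
  rw [unitStepMap_eq_smul_e3OfK]
  have hK : ∀ j, ∃ δ C : ℝ, 0 < δ ∧ Decays (unitK (sfStep Lc j) (smStep d Lc j) (coDressKBmAt (toSite rr) Lc (KInvStep (d := d) Lc j))) C δ := by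
    intro j
    obtain ⟨δK, CK, hδK, -, hG⟩ := decays_coDressKBmAt_KInvStep (d := d) hrr j
    exact ⟨δK, _, hδK, decays_unitK hG⟩
  exact divV_transport_eq_zero_of_divFree_of_exists (c := fun _ => cE * (Lc : ℝ) ^ (2 * (d + 1))) (cH := fun _ => ((Lc : ℝ) ^ (d + 1))⁻¹)
    hK (one_le_of_neZero Lc) hS (fun j => hH_unitK_comb hrr j) hdiv m k y

/-- [folklore] **AN INTERIOR LETTER IS INVISIBLE TO THE LITERAL's TRANSPORT FROM THE NEXT LEVEL ON**: all `Lc`-block fluxes of the bounded letter vanish ⇒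
`divV (transport (unitStepMap Lc (toSite rr) cE) m (k+1) S) ≡ 0` for every `k`. -/
theorem divV_transport_unitStepMap_succ_eq_zero_of_fluxFree (hrr : rr ∈ box (d + 1) Lc) (cE : ℝ) (hS : ∀ κ u x z a b, |S κ u x z a b| ≤ B)
    (hflux : ∀ y : Fin (d + 1) → ℤ, ∑ v ∈ box (d + 1) Lc, divV S ((Lc : ℤ) • y + toSite v) = 0) (m k : ℕ) (y : Fin (d + 1) → ℤ) :
    divV (transport (unitStepMap Lc (toSite rr) cE) m (k + 1) S) y = 0 := by
  rw [unitStepMap_eq_smul_e3OfK]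
  have hK : ∀ j, ∃ δ C : ℝ, 0 < δ ∧ Decays (unitK (sfStep Lc j) (smStep d Lc j) (coDressKBmAt (toSite rr) Lc (KInvStep (d := d) Lc j))) C δ := by
    intro j
    obtain ⟨δK, CK, hδK, -, hG⟩ := decays_coDressKBmAt_KInvStep (d := d) hrr j
    exact ⟨δK, _, hδK, decays_unitK hG⟩
  exact divV_transport_succ_eq_zero_of_fluxFree_of_exists (c := fun _ => cE * (Lc : ℝ) ^ (2 * (d + 1))) (cH := fun _ => ((Lc : ℝ) ^ (d + 1))⁻¹)
    hK (one_le_of_neZero Lc) hS (fun j => hH_unitK_comb hrr j) hflux m k y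

/-- [folklore] **PERSISTENCE FOR THE LITERAL's TRANSPORT**: a bounded letter off the boundary layers of `U_{Lc^k}(T)` contributes ZERO flux through `T` after `k` levels of
`transport (unitStepMap Lc (toSite rr) cE) m`. -/
theorem regionSum_divV_transport_unitStepMap_eq_zero_of_offLayers (hrr : rr ∈ box (d + 1) Lc) (cE : ℝ) (hS : ∀ κ u x z a b, |S κ u x z a b| ≤ B)
    (m k : ℕ) (T : Finset (Site (d + 1)))
    (hin : ∀ μ, ∀ w ∈ (T.biUnion (fun Y => (box (d + 1) (Lc ^ k)).image (fun v => ((Lc ^ k : ℕ) : ℤ) • Y + toSite v))).image (fun u => u - unitVec μ)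
        \ T.biUnion (fun Y => (box (d + 1) (Lc ^ k)).image (fun v => ((Lc ^ k : ℕ) : ℤ) • Y + toSite v)), S μ w = 0)
    (hout : ∀ μ, ∀ u ∈ T.biUnion (fun Y => (box (d + 1) (Lc ^ k)).image (fun v => ((Lc ^ k : ℕ) : ℤ) • Y + toSite v))
        \ (T.biUnion (fun Y => (box (d + 1) (Lc ^ k)).image (fun v => ((Lc ^ k : ℕ) : ℤ) • Y + toSite v))).image (fun u => u - unitVec μ), S μ u = 0) :
    ∑ Y ∈ T, divV (transport (unitStepMap Lc (toSite rr) cE) m k S) Y = 0 := by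
  rw [unitStepMap_eq_smul_e3OfK]
  have hK : ∀ j, ∃ δ C : ℝ, 0 < δ ∧ Decays (unitK (sfStep Lc j) (smStep d Lc j) (coDressKBmAt (toSite rr) Lc (KInvStep (d := d) Lc j))) C δ := by
    intro j
    obtain ⟨δK, CK, hδK, -, hG⟩ := decays_coDressKBmAt_KInvStep (d := d) hrr j
    exact ⟨δK, _, hδK, decays_unitK hG⟩
  exact regionSum_divV_transport_eq_zero_of_offLayers_of_exists (c := fun _ => cE * (Lc : ℝ) ^ (2 * (d + 1))) (cH := fun _ => ((Lc : ℝ) ^ (d + 1))⁻¹)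
    hK (one_le_of_neZero Lc) hS (fun j => hH_unitK_comb hrr j) m k T hin hout

end Literal

end Summit.QuantumFields.BalabanUV.Beta.GAN24.FluxTowerCoClosed

end
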